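import Summits.CriticalPhenomena.PercolationContinuityZ3.Theorems.PercNearOneGluingNoHeavyLowerTailThreePartitionCombBridge
import Summits.CriticalPhenomena.PercolationContinuityZ3.Theorems.PercNearOneGluingNoHeavyLowerTailSahiCombStrata

/-!
# `NoHeavyLowerTail` (crux stmt-CriticalPhenomena-4575), route P3 (Ahlswede–Daykin): the bridge (★★) ⟺ (M⁺-3), CONVERSE half —
# uniqueness of tensor-Bernstein coefficients and `MasterFamilyCombPos 3 → ThreePartitionPositivityTwisted`

Support file (cell `prim-l12`, seat P3, gen 2; `--supports stmt-CriticalPhenomena-4575`), companion of `…ThreePartitionCombBridge`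
(which proves `ThreePartitionPositivityTwisted → MasterFamilyCombPos 3`).  No `sorry`, standard axioms; nothing asserted about the crux,
no conjecture assumed except as an explicit hypothesis.

* **`bern_coeff_unique`** — UNIQUENESS OF TENSOR-BERNSTEIN COEFFICIENTS: two coefficient tables on the box `j ≤ c` that give the same
  function `Σ_j N_j ∏_e p_e^{j_e}(1−p_e)^{c_e−j_e}` on the closed cube `[0,1]^ι` coincide.  Proof: substitute `p_e = t_e/(1+t_e)`,
  multiply by `∏_e (1+t_e)^{c_e}` (`bern_cubePt_mul`: the basis function becomes the monomial `∏_e t_e^{j_e}`), and compare the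
  multivariate polynomials `Σ_j N_j X^j` (`coefPoly`) on the infinite box `[0,∞)^ι` (`MvPolynomial.funext_set`).  Consequence for the
  comb hierarchy (`…SahiCombPositivity`, where `CombPos c F` asks for SOME nonnegative representation): `CombPos` is equivalent to
  nonnegativity of THE coefficients; for `E₃` these are the three-copy fibre sums (`combCoef3_nonneg_of_combPos`).
* **`threePartNT_comap_equiv`** — the twisted three-partition functional is invariant under relabelling the ground set along an
  equivalence (families and twist pulled back; `tri_comap_equiv`, `triT_comap_equiv`).
* **`threePartNT_nonneg_of_combPos`** (per triple) and **`threePartitionPositivityTwisted_of_masterFamilyCombPos_three`** —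
  `(M⁺-3) ⟹ (★★)`: for `(ι, τ, 𝒰, 𝒱, 𝒲)` take the all-active profile `j = 1 + 1_τ` on `ι` itself; by `combCoef3_eq_threePartNT` its
  fibre sum is `threePartNT` of the `j`-sections on `Act j ≃ ι`, which transports to `threePartNT τ 𝒰 𝒱 𝒲`, and it is `≥ 0` by uniqueness.
* **`threePartNT_nonneg_of_not_residual`** — COUNTING FORM OF THE FIVE STRATA: by `…SahiCombStrata` and the per-triple transfer,
  `threePartNT τ U₀ U₁ U₂ ≥ 0` for every twist whenever the triple has a comparable pair, a cylinder member, an independent member, two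
  members with disjoint supports, or a member containing the meet of the other two; (★★) is open exactly on the residual class.
* **`threePartitionPositivityTwisted_iff_masterFamilyCombPos_three`** — `(★★) ⟺ (M⁺-3)`: this seat's three-partition conjecture
  (`…ThreePartitionADTwisted`) and prim-masterthm's comb positivity of `E₃` (`…SahiCombMasterFamily`) are ONE statement.  In particular
  every stratum on which (M⁺-3) is a theorem (`…SahiCombStrata`: comparable pair, cylinder member, independent member, disjoint supports,
  a member containing the meet of the other two) is a stratum of three-partition positivity, and the AD merge chain / no-go certificates
  of this seat are statements about the tensor-Bernstein coefficients of `E₃`.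
-/

noncomputable section

open scoped Classical symmDiff
open Finset

namespace Summit.CriticalPhenomena.PercolationContinuityZ3.Theorems.ThreePartition

open Literature.Combinatorics.Sahi2008
open Literature.Probability.Percolation.DecisionTree (ind ind_of_mem ind_of_not_mem ind_nonneg)
open SahiComb

variable {ι : Type} [Fintype ι]

/-! ### Uniqueness of tensor-Bernstein coefficients -/

/-- The multivariate polynomial `Σ_{j ≤ c} N_j X^j` attached to a coefficient table. [this work] -/
def coefPoly (c : ι → ℕ) (N : (ι → ℕ) → ℝ) : MvPolynomial ι ℝ :=
  ∑ j ∈ box c, MvPolynomial.monomial (Finsupp.equivFunOnFinite.symm j) (N j)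

/-- The coefficients of `coefPoly` are the table entries. [this work] -/
theorem coeff_coefPoly (c : ι → ℕ) (N : (ι → ℕ) → ℝ) {j : ι → ℕ} (hj : j ∈ box c) :
    MvPolynomial.coeff (Finsupp.equivFunOnFinite.symm j) (coefPoly c N) = N j := by
  unfold coefPoly
  rw [MvPolynomial.coeff_sum]
  simp only [MvPolynomial.coeff_monomial, EmbeddingLike.apply_eq_iff_eq]
  rw [sum_ite_eq' (box c) j N, if_pos hj]

/-- Evaluation of `coefPoly`: `Σ_{j ≤ c} N_j ∏_e t_e^{j_e}`. [this work] -/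
theorem eval_coefPoly (c : ι → ℕ) (N : (ι → ℕ) → ℝ) (t : ι → ℝ) :
    MvPolynomial.eval t (coefPoly c N) = ∑ j ∈ box c, N j * ∏ e, t e ^ j e := by
  unfold coefPoly
  rw [map_sum]
  refine sum_congr rfl fun j _ => ?_
  rw [MvPolynomial.eval_monomial, Finsupp.prod_fintype _ _ fun e => pow_zero (t e)]
  simp only [Finsupp.coe_equivFunOnFinite_symm]

/-- The point of the cube with coordinates `t_e / (1 + t_e)` (`t ≥ 0`). [this work] -/
def cubePt (t : ι → ℝ) (ht : ∀ e, 0 ≤ t e) : ι → unitInterval :=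
  fun e => ⟨t e / (1 + t e), ⟨div_nonneg (ht e) (by linarith [ht e]),
    (div_le_one (by linarith [ht e])).2 (by linarith [ht e])⟩⟩

/-- One coordinate of the substitution `p = t/(1+t)`: `p^j (1−p)^{c−j} (1+t)^c = t^j` for `j ≤ c`. [folklore] -/
theorem sub_pow_identity {t : ℝ} (ht : 0 ≤ t) {j c : ℕ} (hjc : j ≤ c) :
    (t / (1 + t)) ^ j * (1 - t / (1 + t)) ^ (c - j) * (1 + t) ^ c = t ^ j := by
  have h1 : (1 : ℝ) + t ≠ 0 := by positivity
  obtain ⟨d, rfl⟩ : ∃ d, c = j + d := ⟨c - j, by omega⟩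
  rw [Nat.add_sub_cancel_left, show 1 - t / (1 + t) = 1 / (1 + t) by field_simp; ring, div_pow, div_pow, one_pow,
    pow_add]
  field_simp

/-- The substitution on the whole basis function: `bern c j (t/(1+t)) · ∏_e (1+t_e)^{c_e} = ∏_e t_e^{j_e}` for `j ≤ c`. [this work] -/
theorem bern_cubePt_mul (c : ι → ℕ) {t : ι → ℝ} (ht : ∀ e, 0 ≤ t e) {j : ι → ℕ} (hj : j ∈ box c) :
    bern c j (cubePt t ht) * ∏ e, (1 + t e) ^ c e = ∏ e, t e ^ j e := by
  unfold bern
  rw [← prod_mul_distrib]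
  refine prod_congr rfl fun e _ => ?_
  exact sub_pow_identity (ht e) (mem_box.1 hj e)

/-- **Uniqueness of tensor-Bernstein coefficients.**  Two coefficient tables on the box `j ≤ c` giving the same function on the
closed cube `[0,1]^ι` are equal (substitute `p = t/(1+t)`, clear denominators, and compare the resulting multivariate polynomials on
the infinite box `[0,∞)^ι`, `MvPolynomial.funext_set`).  Hence `CombPos c F` is equivalent to nonnegativity of THE tensor-Bernstein
coefficients of `F`. [this work] -/
theorem bern_coeff_unique {c : ι → ℕ} {N N' : (ι → ℕ) → ℝ}
    (h : ∀ p : ι → unitInterval, ∑ j ∈ box c, N j * bern c j p = ∑ j ∈ box c, N' j * bern c j p)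
    {j : ι → ℕ} (hj : j ∈ box c) : N j = N' j := by
  have hP : coefPoly c N = coefPoly c N' := by
    refine MvPolynomial.funext_set (fun _ => Set.Ici (0 : ℝ)) (fun _ => Set.Ici_infinite 0) fun t ht => ?_
    have ht' : ∀ e, 0 ≤ t e := fun e => ht e (Set.mem_univ e)
    have key : ∀ M : (ι → ℕ) → ℝ, MvPolynomial.eval t (coefPoly c M) =
        (∑ j ∈ box c, M j * bern c j (cubePt t ht')) * ∏ e, (1 + t e) ^ c e := by
      intro M
      rw [eval_coefPoly, sum_mul]
      refine sum_congr rfl fun j hj => ?_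
      rw [mul_assoc, bern_cubePt_mul c ht' hj]
    rw [key N, key N', h]
  have h1 := coeff_coefPoly c N hj
  rw [hP, coeff_coefPoly c N' hj] at h1
  exact h1.symm

/-- In particular the three-copy fibre sums ARE the coefficients of any comb-positivity certificate of `E₃`: comb positivity of
`E₃(1_U,1_V,1_W)` forces `combCoef3 U V W j ≥ 0` for every profile `j`. [this work] -/
theorem combCoef3_nonneg_of_combPos {U V W : Set (Set ι)}
    (h : CombPos (fun _ : ι => 3) (fun p => sahiE (bernoulliWeight p) 3 ![ind U, ind V, ind W])) (j : ι → ℕ) :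
    0 ≤ combCoef3 U V W j := by
  by_cases hj : j ∈ box (fun _ : ι => 3)
  · obtain ⟨N, hN, hF⟩ := h
    have hu := bern_coeff_unique (N := combCoef3 U V W) (N' := N)
      (fun p => by rw [← sahiE_three_ind_bernstein]; exact hF p) hj
    rw [hu]; exact hN j
  · rw [mem_box] at hj
    rw [combCoef3_eq_zero_of_not_le U V W hj]

/-! ### Transport of the three-partition counts along an equivalence of ground sets -/

section Transport

variable {α β : Type} [Fintype α] [Fintype β]

/-- Pull back a family of subsets of `β` to subsets of `α` along `φ : α ≃ β`. [this work] -/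
def comapFam (φ : α ≃ β) (U : Set (Set β)) : Set (Set α) := {T | φ '' T ∈ U}

omit [Fintype α] [Fintype β] in
/-- `comapFam` commutes with intersections. [this work] -/
theorem comapFam_inter (φ : α ≃ β) (U V : Set (Set β)) : comapFam φ (U ∩ V) = comapFam φ U ∩ comapFam φ V := rfl

/-- 3-partition counts are invariant under relabelling the ground set. [this work] -/
theorem tri_comap_equiv (φ : α ≃ β) (P : Set β → Set β → Set β → Prop) :
    tri (fun S₁ S₂ S₃ : Set α => P (φ '' S₁) (φ '' S₂) (φ '' S₃)) = tri P := by
  unfold tri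
  refine card_nbij' (fun q => (φ '' q.1, φ '' q.2)) (fun q => (φ ⁻¹' q.1, φ ⁻¹' q.2)) (fun q hq => ?_) (fun q hq => ?_)
    (fun q _ => ?_) (fun q _ => ?_)
  · simp only [coe_filter, mem_univ, true_and, Set.mem_setOf_eq] at hq ⊢
    refine ⟨(Set.disjoint_image_iff φ.injective).2 hq.1, ?_⟩
    rw [← Set.image_union, ← Set.image_compl_eq φ.bijective]
    exact hq.2
  · simp only [coe_filter, mem_univ, true_and, Set.mem_setOf_eq] at hq ⊢
    refine ⟨?_, ?_⟩
    · have := (Set.disjoint_image_iff φ.injective (s := φ ⁻¹' q.1) (t := φ ⁻¹' q.2))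
      rw [Set.image_preimage_eq _ φ.surjective, Set.image_preimage_eq _ φ.surjective] at this
      exact this.1 hq.1
    · rw [Set.image_preimage_eq _ φ.surjective, Set.image_preimage_eq _ φ.surjective, ← Set.preimage_union,
        ← Set.preimage_compl, Set.image_preimage_eq _ φ.surjective]
      exact hq.2
  · simp only [Set.preimage_image_eq _ φ.injective]
  · simp only [Set.image_preimage_eq _ φ.surjective]

/-- Twisted counts are invariant under relabelling (twist and families pulled back). [this work] -/
theorem triT_comap_equiv (φ : α ≃ β) (τ : Set β) (P : Set β → Set β → Set β → Prop) :
    triT (φ ⁻¹' τ) (fun x₁ x₂ x₃ : Set α => P (φ '' x₁) (φ '' x₂) (φ '' x₃)) = triT τ P := by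
  have key : ∀ S : Set α, φ '' (S ∆ (φ ⁻¹' τ)) = (φ '' S) ∆ τ := fun S => by
    rw [Set.image_symmDiff φ.injective, Set.image_preimage_eq _ φ.surjective]
  unfold triT
  simp only [key]
  exact tri_comap_equiv φ (fun y₁ y₂ y₃ => P (y₁ ∆ τ) (y₂ ∆ τ) (y₃ ∆ τ))

/-- `topT` is invariant under relabelling. [this work] -/
theorem topT_comap_equiv (φ : α ≃ β) (τ : Set β) (C : Set (Set β)) :
    topT (φ ⁻¹' τ) (comapFam φ C) = topT τ C :=
  triT_comap_equiv φ τ (fun _ _ y₃ => y₃ ∈ C)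

/-- `deeT` is invariant under relabelling. [this work] -/
theorem deeT_comap_equiv (φ : α ≃ β) (τ : Set β) (A B : Set (Set β)) :
    deeT (φ ⁻¹' τ) (comapFam φ A) (comapFam φ B) = deeT τ A B :=
  triT_comap_equiv φ τ (fun y₁ _ y₃ => y₁ ∈ A ∧ y₃ ∈ B)

/-- `teeT` is invariant under relabelling. [this work] -/
theorem teeT_comap_equiv (φ : α ≃ β) (τ : Set β) (U V W : Set (Set β)) :
    teeT (φ ⁻¹' τ) (comapFam φ U) (comapFam φ V) (comapFam φ W) = teeT τ U V W :=
  triT_comap_equiv φ τ (fun y₁ y₂ y₃ => y₁ ∈ U ∧ y₂ ∈ V ∧ y₃ ∈ W)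

/-- **The twisted three-partition functional is invariant under relabelling the ground set.** [this work] -/
theorem threePartNT_comap_equiv (φ : α ≃ β) (τ : Set β) (U V W : Set (Set β)) :
    threePartNT (φ ⁻¹' τ) (comapFam φ U) (comapFam φ V) (comapFam φ W) = threePartNT τ U V W := by
  unfold threePartNT
  simp only [← comapFam_inter]
  rw [topT_comap_equiv, teeT_comap_equiv, deeT_comap_equiv, deeT_comap_equiv, deeT_comap_equiv]

end Transport

/-! ### (M⁺-3) ⟹ (★★) -/

omit [Fintype ι] in
/-- When no coordinate is plugged (`j_e ≠ 3` everywhere) the lift is the plain image under the inclusion. [this work] -/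
theorem liftSet_eq_image {j : ι → ℕ} (hj : ∀ e, j e ≠ 3) (T : Set (Act j)) : liftSet j T = Subtype.val '' T := by
  ext e
  simp only [liftSet, Set.mem_setOf_eq, hj e, false_or, Set.mem_image]
  constructor
  · rintro ⟨h, hm⟩; exact ⟨⟨e, h⟩, hm, rfl⟩
  · rintro ⟨x, hx, rfl⟩; exact ⟨x.2, by simpa using hx⟩

/-- **Per-triple transfer.**  If `E₃(1_U,1_V,1_W)` is comb-positive on the cube `[0,1]^ι` then `threePartNT τ U V W ≥ 0` for EVERY
twist `τ ⊆ ι` (no monotonicity needed): take the all-active profile `j = 1 + 1_τ` on `ι` itself; its fibre sum is `threePartNT` of the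
`j`-sections on `Act j ≃ ι` (`combCoef3_eq_threePartNT`), which transports to `threePartNT τ U V W` (`threePartNT_comap_equiv`), and it
is `≥ 0` by uniqueness of Bernstein coefficients (`combCoef3_nonneg_of_combPos`). [this work] -/
theorem threePartNT_nonneg_of_combPos (τ : Set ι) {U V W : Set (Set ι)}
    (hC : CombPos (fun _ : ι => 3) (fun p => sahiE (bernoulliWeight p) 3 ![ind U, ind V, ind W])) :
    0 ≤ threePartNT τ U V W := by
  let j : ι → ℕ := fun e => if e ∈ τ then 2 else 1
  have hj3 : ∀ e, j e ≤ 3 := fun e => by dsimp only [j]; split_ifs <;> omega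
  have hjne : ∀ e, j e ≠ 3 := fun e => by dsimp only [j]; split_ifs <;> omega
  have hact : ∀ e, j e = 1 ∨ j e = 2 := fun e => by dsimp only [j]; split_ifs <;> omega
  let φ : Act j ≃ ι := Equiv.subtypeUnivEquiv hact
  have hφ : ∀ T : Set (Act j), φ '' T = Subtype.val '' T := fun T => rfl
  have h0 := combCoef3_nonneg_of_combPos hC j
  rw [combCoef3_eq_threePartNT U V W hj3] at h0
  have h1 : (0 : ℤ) ≤ threePartNT (twist j) (secFam j U) (secFam j V) (secFam j W) := by exact_mod_cast h0
  have hτ : twist j = φ ⁻¹' τ := by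
    ext e
    simp only [twist, Set.mem_setOf_eq, Set.mem_preimage, φ, Equiv.subtypeUnivEquiv_apply]
    dsimp only [j]
    split_ifs with he <;> simp [he]
  have hsec : ∀ X : Set (Set ι), secFam j X = comapFam φ X := fun X => by
    ext T
    simp only [secFam, comapFam, Set.mem_setOf_eq, liftSet_eq_image hjne, hφ]
  rw [hτ, hsec, hsec, hsec, threePartNT_comap_equiv] at h1
  exact h1

/-- Repackaging a `Fin 3`-family of indicators as a matrix literal (plumbing). [folklore] -/
theorem combPos_vec_iff (U : Fin 3 → Set (Set ι)) :
    CombPos (fun _ : ι => 3) (fun p => sahiE (bernoulliWeight p) 3 (fun k => ind (U k))) ↔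
      CombPos (fun _ : ι => 3) (fun p => sahiE (bernoulliWeight p) 3 ![ind (U 0), ind (U 1), ind (U 2)]) := by
  have hfun : (fun k => ind (U k)) = ![ind (U 0), ind (U 1), ind (U 2)] := by
    funext k; fin_cases k <;> rfl
  rw [hfun]

/-- **(M⁺-3) ⟹ (★★).**  Comb positivity of `E₃` on every finite product cube implies twisted three-partition positivity. [this work] -/
theorem threePartitionPositivityTwisted_of_masterFamilyCombPos_three (h : MasterFamilyCombPos 3) :
    ThreePartitionPositivityTwisted := by
  intro α _ τ U V W hU hV hW
  have hC := (combPos_vec_iff ![U, V, W]).1 (h α ![U, V, W] fun k => by fin_cases k <;> assumption)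
  exact threePartNT_nonneg_of_combPos τ hC

/-- **Three-partition positivity OFF THE RESIDUAL CLASS, for every twist** (counting form of `…SahiCombStrata`'s
`combPos_sahiE_three_of_not_residual`, through the bridge): for three increasing families of a finite cube with a comparable pair, or a
cylinder member, or a member determined by coordinates independent of the other two, or two members with disjoint supports, or a member
containing the intersection of the other two, `threePartNT τ (U 0) (U 1) (U 2) ≥ 0` for all `τ`.  The RESIDUAL class (antichain, no
cylinder, pairwise dependent, no member ⊇ the meet of the others) is exactly where (★★) — equivalently (M⁺-3) — remains open. [this work] -/
theorem threePartNT_nonneg_of_not_residual (τ : Set ι) (U : Fin 3 → Set (Set ι)) (hU : ∀ j, IsUpperSet (U j))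
    (h : (∃ i j : Fin 3, j ≠ i ∧ U j ⊆ U i) ∨ (∃ (m : Fin 3) (S : Set ι), U m = {ω : Set ι | S ⊆ ω}) ∨
      (∃ (m : Fin 3) (F : Finset ι), Literature.Probability.Percolation.DeterminedBy (U m) (↑F : Set ι) ∧
        ∀ j, Literature.Probability.Percolation.DeterminedBy (U (m.succAbove j)) (↑F : Set ι)ᶜ) ∨
      (∃ m : Fin 3, SuppZeroFlag 2 (fun j => U (m.succAbove j))) ∨
      (∃ m : Fin 3, (⋂ j, U (m.succAbove j)) ⊆ U m)) :
    0 ≤ threePartNT τ (U 0) (U 1) (U 2) :=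
  threePartNT_nonneg_of_combPos τ ((combPos_vec_iff U).1 (combPos_sahiE_three_of_not_residual U hU h))

/-- **(★★) ⟺ (M⁺-3)**: twisted three-partition positivity and comb positivity of `E₃` are the same statement. [this work] -/
theorem threePartitionPositivityTwisted_iff_masterFamilyCombPos_three :
    ThreePartitionPositivityTwisted ↔ MasterFamilyCombPos 3 :=
  ⟨masterFamilyCombPos_three_of_threePartitionPositivityTwisted, threePartitionPositivityTwisted_of_masterFamilyCombPos_three⟩

end Summit.CriticalPhenomena.PercolationContinuityZ3.Theorems.ThreePartition
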